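import Summits.CriticalPhenomena.SAWScalingLimit.Theorems.SAWLeftRightFKGFKGToTraversalBoundWitnessCfg
import Summits.CriticalPhenomena.SAWScalingLimit.Theorems.SAWLeftRightFKGFKGToTraversalBoundFreeCarrier
import Literature.Probability.LatticeModels.KCFrozenBoundaryConnected
import HarnessLib

/-!
# The rest class is `4`-connected (witness glue T3a of `stub_necklaceWitnessFarU`)

Crux `SAWLeftRightFKG.FKGToTraversalBound` (stmt-CriticalPhenomena-1878), line `slit-necklace`, registered stub
`witness_restClass_connected`.

For a far-tip configuration `cfg : FarTipCfg D` (…WitnessCfg.lean) the REST CLASS `Ω₀` consists of the sites off the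
lattice domain `Λ`, the spine sites `Sp`, and the exterior vertices of the chord `γ` (index `< τ` or `> τ'`) that are
interior vertices of no non-degenerate far piece other than the piece `P = (i, j)` itself.  `witness_restClass_connected`
proves that any two sites of `Ω₀` are joined by a lattice walk all of whose vertices are in `Ω₀`:

* the trace of the presenting walk `C` is off `Λ` (`KilledReduction.notMem_meshDomain_of_mem_support`, transported
  to mesh `δ` by `CornerLoc.meshDomain_dom`), and any two sites off `Λ` are joined off `Λ` because `Λ` is finite and
  hole-free (`KilledReduction.holeFree_meshDomain_dom`, `induce_compl_preconnected_of_holeFree`);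
* a spine site is joined to the trace through spine and trace sites (the attachment hypothesis `hatt`);
* an exterior vertex `γ m₀` off the spine walks along `γ`, AWAY from the middle `[τ, τ']` (down if `m₀ < τ`, up if
  `τ' < m₀`), to the nearest spine index; the indices passed are off the spine, hence in the same pieces as `m₀`, so the
  piece condition transfers from `γ m₀` to them.

Everything is folklore lattice combinatorics; no named fact is used.
-/

noncomputable section

open Filter Topology Set Metric SimpleGraph
open Literature.Probability.LatticeModels
open Literature.Probability.RandomPlanarGeometry
open Literature.Probability.RandomPlanarGeometry.SAW
open Summit.CriticalPhenomena.SAWScalingLimit.Theorems.FKGToTraversalBound.Negative (dom)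

namespace Summit.CriticalPhenomena.SAWScalingLimit.Theorems.FKGToTraversalBound.SlitNecklace

open ExcursionDomination.KilledReduction (holeFree_meshDomain_dom notMem_meshDomain_of_mem_support)

variable {D : DobrushinDomain}

/-! ### Walking along a walk of a subgraph of `ℤ²` between two indices -/

/-- The vertices of indices `a ≤ … ≤ b ≤ |p|` of a walk `p` in a subgraph of `ℤ²` are joined by a lattice walk
through exactly those vertices. [folklore] -/
theorem rest_exists_walk_getVert {G : SimpleGraph (Site 2)} (hG : G ≤ zdGraph 2) {u v : Site 2}
    (p : G.Walk u v) {a b : ℕ} (hab : a ≤ b) (hb : b ≤ p.length) :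
    ∃ w : (zdGraph 2).Walk (p.getVert a) (p.getVert b),
      ∀ z ∈ w.support, ∃ m, a ≤ m ∧ m ≤ b ∧ p.getVert m = z := by
  obtain ⟨d, rfl⟩ := Nat.exists_eq_add_of_le hab
  induction d with
  | zero =>
    refine ⟨Walk.nil, fun z hz => ⟨a, le_rfl, Nat.le_add_right a 0, ?_⟩⟩
    rw [Walk.support_nil, List.mem_singleton] at hz
    exact hz.symm
  | succ d ih =>
    obtain ⟨w, hw⟩ := ih (Nat.le_add_right a d) (by omega)
    have hadj : (zdGraph 2).Adj (p.getVert (a + d)) (p.getVert (a + d + 1)) :=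
      hG (p.adj_getVert_succ (by omega))
    refine ⟨w.concat hadj, fun z hz => ?_⟩
    rw [Walk.support_concat, List.mem_append, List.mem_singleton] at hz
    rcases hz with hz | rfl
    · obtain ⟨m, ham, hmb, rfl⟩ := hw z hz
      exact ⟨m, ham, by omega, rfl⟩
    · exact ⟨a + d + 1, by omega, by omega, rfl⟩

/-! ### Sites off `Λ` and spine sites -/

/-- Vertices of the presenting walk `C` are off the lattice domain `Λ`. [folklore] -/
theorem rest_notMem_Λ_of_mem_support (cfg : FarTipCfg D) {q : Site 2} (hq : q ∈ cfg.C.support) :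
    q ∉ cfg.Λ := by
  have e : cfg.Λ = meshDomain (dom cfg.C 1) 1 := LeftRightFKG.CornerLoc.meshDomain_dom cfg.C cfg.hδ.ne'
  rw [e]
  exact notMem_meshDomain_of_mem_support cfg.C hq

/-- Any two sites off `Λ` are joined off `Λ`: `Λ` is finite and hole-free, so its complement induces a
preconnected subgraph of `ℤ²`. [folklore] -/
theorem rest_walk_compl (cfg : FarTipCfg D) {x y : Site 2} (hx : x ∉ cfg.Λ) (hy : y ∉ cfg.Λ) :
    ∃ w : (zdGraph 2).Walk x y, ∀ z ∈ w.support, z ∉ cfg.Λ := by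
  have hfin : (cfg.Λ).Finite :=
    meshDomain_finite (LeftRightFKG.CornerLoc.isBounded_dom cfg.C cfg.δ) cfg.hδ
  have hco : (↑hfin.toFinset : Set (Site 2)) = cfg.Λ := hfin.coe_toFinset
  have hhf : HoleFree (↑hfin.toFinset : Set (Site 2)) := by
    rw [hco]
    exact holeFree_meshDomain_dom cfg.C cfg.hδ.ne'
  have hx' : x ∈ (↑hfin.toFinset : Set (Site 2))ᶜ := by rw [hco]; exact hx
  have hy' : y ∈ (↑hfin.toFinset : Set (Site 2))ᶜ := by rw [hco]; exact hy
  obtain ⟨p⟩ := induce_compl_preconnected_of_holeFree hhf ⟨x, hx'⟩ ⟨y, hy'⟩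
  obtain ⟨q, hq⟩ := free_exists_walk_of_induce_compl hx' hy' p
  exact ⟨q, fun z hz h => hq z hz (by rw [hco]; exact h)⟩

/-- A spine site is joined to a site off `Λ` through spine sites and sites off `Λ`: the attachment walk to the
trace of `C`, whose vertices are off `Λ`. [folklore] -/
theorem rest_walk_spine (cfg : FarTipCfg D) {k : Site 2} (hk : k ∈ cfg.Sp) :
    ∃ (q : Site 2) (w : (zdGraph 2).Walk k q), q ∉ cfg.Λ ∧ ∀ z ∈ w.support, z ∉ cfg.Λ ∨ z ∈ cfg.Sp := by
  obtain ⟨q, w, hqC, hw⟩ := cfg.hatt k hk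
  refine ⟨q, w, rest_notMem_Λ_of_mem_support cfg hqC, fun z hz => ?_⟩
  rcases hw z hz with h | h
  · exact Or.inr h
  · exact Or.inl (rest_notMem_Λ_of_mem_support cfg h)

/-! ### Pieces and the piece condition -/

/-- The end `pend i'` of a far start `i'` closes a piece `(i', pend i')` of `γ` off the spine. [folklore] -/
theorem rest_isPiece_pend (cfg : FarTipCfg D) {i' : ℕ} (hi' : i' ∈ cfg.farStarts) :
    IsPiece cfg.γ (↑cfg.Sp : Set (Site 2)) i' (cfg.pend i') := by
  classical
  obtain ⟨j', hfp⟩ := hi'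
  have hex : ∃ j', IsPiece cfg.γ (↑cfg.Sp : Set (Site 2)) i' j' := ⟨j', hfp.1⟩
  show IsPiece cfg.γ (↑cfg.Sp : Set (Site 2)) i' (PresCfg.pend cfg.toPresCfg i')
  unfold PresCfg.pend
  rw [dif_pos hex]
  exact Nat.find_spec hex

/-- **Transfer of the piece condition along a spine-free index interval.**  If the indices `lo ≤ … ≤ hi ≤ |γ|`
are all off the spine and `m₀`, `m` lie in `[lo, hi]`, then every far piece with `γ m` in its interior has
`γ m₀` in its interior; so the piece condition of the rest class passes from `γ m₀` to `γ m`. [folklore] -/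
theorem rest_notMem_V_of_interval (cfg : FarTipCfg D) {lo hi m₀ m : ℕ} (hhi : hi ≤ cfg.γ.length)
    (hfree : ∀ n, lo ≤ n → n ≤ hi → cfg.γ.getVert n ∉ cfg.Sp) (hm₀ : lo ≤ m₀ ∧ m₀ ≤ hi)
    (hm : lo ≤ m ∧ m ≤ hi)
    (hV : ∀ i'' ∈ cfg.farStarts, cfg.NonDeg i'' → i'' ≠ cfg.i → cfg.γ.getVert m₀ ∉ cfg.V i'' (cfg.pend i'')) :
    ∀ i'' ∈ cfg.farStarts, cfg.NonDeg i'' → i'' ≠ cfg.i → cfg.γ.getVert m ∉ cfg.V i'' (cfg.pend i'') := by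
  intro i'' hfs hnd hne hmem
  obtain ⟨m', h1, h2, heq⟩ := (cfg.mem_V_iff).1 hmem
  obtain ⟨hsi, hsj, -, -⟩ := rest_isPiece_pend cfg hfs
  have hm'L : m' ≤ cfg.γ.length := h2.le.trans hsj.1
  have hmm' : m' = m := cfg.hγ.getVert_injOn hm'L (hm.2.trans hhi) heq
  subst hmm'
  have hilo : i'' < lo := by
    by_contra h
    exact hfree i'' (not_lt.1 h) (by omega) (Finset.mem_coe.1 hsi.2)
  have hhi' : hi < cfg.pend i'' := by
    by_contra h
    exact hfree _ (by omega) (not_lt.1 h) (Finset.mem_coe.1 hsj.2)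
  exact hV i'' hfs hnd hne ((cfg.mem_V_iff).2 ⟨m₀, by omega, by omega, rfl⟩)

/-- The chord starts on the spine: `γ 0 = a₀ ∈ Ka`. [folklore] -/
theorem rest_getVert_zero_mem (cfg : FarTipCfg D) : cfg.γ.getVert 0 ∈ cfg.Sp := by
  rw [Walk.getVert_zero, PresCfg.Sp_def]
  exact Finset.mem_union_left _ (Finset.mem_union_left _ cfg.ha₀)

/-- The chord ends on the spine: `γ |γ| = b₀ ∈ Kb`. [folklore] -/
theorem rest_getVert_length_mem (cfg : FarTipCfg D) : cfg.γ.getVert cfg.γ.length ∈ cfg.Sp := by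
  rw [Walk.getVert_length, PresCfg.Sp_def]
  exact Finset.mem_union_left _ (Finset.mem_union_right _ cfg.hb₀)

/-- The last spine index `i₁ ≤ m₀`. [folklore] -/
theorem rest_exists_last_spineIdx (cfg : FarTipCfg D) (m₀ : ℕ) :
    ∃ i₁, i₁ ≤ m₀ ∧ cfg.γ.getVert i₁ ∈ cfg.Sp ∧ ∀ n, i₁ < n → n ≤ m₀ → cfg.γ.getVert n ∉ cfg.Sp := by
  classical
  exact ⟨Nat.findGreatest (fun n => cfg.γ.getVert n ∈ cfg.Sp) m₀, Nat.findGreatest_le _,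
    Nat.findGreatest_spec (P := fun n => cfg.γ.getVert n ∈ cfg.Sp) (Nat.zero_le _) (rest_getVert_zero_mem cfg),
    fun n h1 h2 => Nat.findGreatest_is_greatest h1 h2⟩

/-- The first spine index `j₁ ≥ m₀` (for `m₀ ≤ |γ|`). [folklore] -/
theorem rest_exists_first_spineIdx (cfg : FarTipCfg D) {m₀ : ℕ} (hm₀ : m₀ ≤ cfg.γ.length) :
    ∃ j₁, m₀ ≤ j₁ ∧ j₁ ≤ cfg.γ.length ∧ cfg.γ.getVert j₁ ∈ cfg.Sp ∧
      ∀ n, m₀ ≤ n → n < j₁ → cfg.γ.getVert n ∉ cfg.Sp := by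
  classical
  have hex : ∃ n, m₀ ≤ n ∧ n ≤ cfg.γ.length ∧ cfg.γ.getVert n ∈ cfg.Sp :=
    ⟨cfg.γ.length, hm₀, le_rfl, rest_getVert_length_mem cfg⟩
  obtain ⟨hj₁m, hj₁L, hj₁S⟩ := Nat.find_spec hex
  exact ⟨Nat.find hex, hj₁m, hj₁L, hj₁S, fun n h1 h2 h3 => Nat.find_min hex h2 ⟨h1, by omega, h3⟩⟩

/-- **From an exterior vertex off the spine to the spine inside the rest class.**  An exterior vertex `z = γ m₀`
of `γ` (index `< τ` or `> τ'`) off the spine satisfying the piece condition walks along `γ`, away from the middle,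
to a spine site through vertices of the rest class. [folklore] -/
theorem rest_walk_ext (cfg : FarTipCfg D) {z : Site 2} (hzE : z ∈ cfg.Ext) (hzS : z ∉ cfg.Sp)
    (hzV : ∀ i'' ∈ cfg.farStarts, cfg.NonDeg i'' → i'' ≠ cfg.i → z ∉ cfg.V i'' (cfg.pend i'')) :
    ∃ (k : Site 2) (w : (zdGraph 2).Walk z k), k ∈ cfg.Sp ∧ ∀ v ∈ w.support,
      v ∉ cfg.Λ ∨ v ∈ cfg.Sp ∨ (v ∈ cfg.Ext ∧
        ∀ i'' ∈ cfg.farStarts, cfg.NonDeg i'' → i'' ≠ cfg.i → v ∉ cfg.V i'' (cfg.pend i'')) := by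
  obtain ⟨m₀, hm₀L, hm₀τ, rfl⟩ := (cfg.mem_Ext_iff).1 hzE
  have hGle : cfg.Dg ≤ zdGraph 2 := (discreteDomainGraph_le_meshGraph _ _).trans (meshGraph_le_zdGraph _ _)
  rcases hm₀τ with hlt | hgt
  · -- walk DOWN to the last spine index `i₁ < m₀`
    obtain ⟨i₁, hi₁m, hi₁S, hmax⟩ := rest_exists_last_spineIdx cfg m₀
    obtain ⟨w, hw⟩ := rest_exists_walk_getVert hGle cfg.γ hi₁m hm₀L
    refine ⟨cfg.γ.getVert i₁, w.reverse, hi₁S, fun v hv => ?_⟩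
    rw [Walk.support_reverse, List.mem_reverse] at hv
    obtain ⟨m, h1, h2, rfl⟩ := hw v hv
    rcases h1.eq_or_lt with rfl | h1
    · exact Or.inr (Or.inl hi₁S)
    · refine Or.inr (Or.inr ⟨(cfg.mem_Ext_iff).2 ⟨m, by omega, Or.inl (by omega), rfl⟩, ?_⟩)
      exact rest_notMem_V_of_interval cfg (lo := i₁ + 1) (hi := m₀) hm₀L
        (fun n hn1 hn2 => hmax n hn1 hn2) ⟨by omega, le_rfl⟩ ⟨h1, h2⟩ hzV
  · -- walk UP to the first spine index `j₁ > m₀`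
    obtain ⟨j₁, hj₁m, hj₁L, hj₁S, hmin⟩ := rest_exists_first_spineIdx cfg hm₀L
    have hlt' : m₀ < j₁ := by
      refine lt_of_le_of_ne hj₁m fun h => hzS ?_
      rw [h]
      exact hj₁S
    obtain ⟨w, hw⟩ := rest_exists_walk_getVert hGle cfg.γ hj₁m hj₁L
    refine ⟨cfg.γ.getVert j₁, w, hj₁S, fun v hv => ?_⟩
    obtain ⟨m, h1, h2, rfl⟩ := hw v hv
    rcases h2.eq_or_lt with rfl | h2
    · exact Or.inr (Or.inl hj₁S)
    · refine Or.inr (Or.inr ⟨(cfg.mem_Ext_iff).2 ⟨m, by omega, Or.inr (by omega), rfl⟩, ?_⟩)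
      exact rest_notMem_V_of_interval cfg (lo := m₀) (hi := j₁ - 1) (by omega)
        (fun n hn1 hn2 => hmin n hn1 (by omega)) ⟨le_rfl, by omega⟩ ⟨h1, by omega⟩ hzV

/-- **Every site of the rest class is joined to a site off `Λ` through sites of the rest class.** [folklore] -/
theorem rest_walk_toCompl (cfg : FarTipCfg D) {z : Site 2}
    (hz : z ∉ cfg.Λ ∨ z ∈ cfg.Sp ∨ (z ∈ cfg.Ext ∧
      ∀ i'' ∈ cfg.farStarts, cfg.NonDeg i'' → i'' ≠ cfg.i → z ∉ cfg.V i'' (cfg.pend i''))) :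
    ∃ (q : Site 2) (w : (zdGraph 2).Walk z q), q ∉ cfg.Λ ∧ ∀ v ∈ w.support,
      v ∉ cfg.Λ ∨ v ∈ cfg.Sp ∨ (v ∈ cfg.Ext ∧
        ∀ i'' ∈ cfg.farStarts, cfg.NonDeg i'' → i'' ≠ cfg.i → v ∉ cfg.V i'' (cfg.pend i'')) := by
  -- spine sites
  have hsp : ∀ k ∈ cfg.Sp, ∃ (q : Site 2) (w : (zdGraph 2).Walk k q), q ∉ cfg.Λ ∧ ∀ v ∈ w.support,
      v ∉ cfg.Λ ∨ v ∈ cfg.Sp ∨ (v ∈ cfg.Ext ∧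
        ∀ i'' ∈ cfg.farStarts, cfg.NonDeg i'' → i'' ≠ cfg.i → v ∉ cfg.V i'' (cfg.pend i'')) := by
    intro k hk
    obtain ⟨q, w, hq, hw⟩ := rest_walk_spine cfg hk
    exact ⟨q, w, hq, fun v hv => (hw v hv).imp_right Or.inl⟩
  rcases hz with hz | hz | ⟨hzE, hzV⟩
  · refine ⟨z, Walk.nil, hz, fun v hv => ?_⟩
    rw [Walk.support_nil, List.mem_singleton] at hv
    rw [hv]
    exact Or.inl hz
  · exact hsp z hz
  · by_cases hzS : z ∈ cfg.Sp
    · exact hsp z hzS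
    obtain ⟨k, w₁, hk, hw₁⟩ := rest_walk_ext cfg hzE hzS hzV
    obtain ⟨q, w₂, hq, hw₂⟩ := hsp k hk
    refine ⟨q, w₁.append w₂, hq, fun v hv => ?_⟩
    rw [Walk.mem_support_append_iff] at hv
    rcases hv with hv | hv
    exacts [hw₁ v hv, hw₂ v hv]

/-! ### The registered stub -/

/-- **Witness glue T3a — the rest class is `4`-connected.**  For a far-tip configuration, any two sites of the rest
class `Ω₀` (sites off the lattice domain `Λ`, spine sites, and exterior vertices of the chord lying in the interior
of no non-degenerate far piece other than `P`) are joined by a lattice walk inside `Ω₀`: both are joined inside `Ω₀`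
to sites off `Λ` (`rest_walk_toCompl`), and the complement of the finite hole-free set `Λ` is connected
(`rest_walk_compl`). [folklore] -/
theorem witness_restClass_connected : ∀ {D : DobrushinDomain} (cfg : FarTipCfg D), ∀ x y : Site 2, (x ∉ cfg.Λ ∨ x ∈ cfg.Sp ∨ (x ∈ cfg.Ext ∧ ∀ i'' ∈ cfg.farStarts, cfg.NonDeg i'' → i'' ≠ cfg.i → x ∉ cfg.V i'' (cfg.pend i''))) → (y ∉ cfg.Λ ∨ y ∈ cfg.Sp ∨ (y ∈ cfg.Ext ∧ ∀ i'' ∈ cfg.farStarts, cfg.NonDeg i'' → i'' ≠ cfg.i → y ∉ cfg.V i'' (cfg.pend i''))) → ∃ w : (zdGraph 2).Walk x y, ∀ z ∈ w.support, z ∉ cfg.Λ ∨ z ∈ cfg.Sp ∨ (z ∈ cfg.Ext ∧ ∀ i'' ∈ cfg.farStarts, cfg.NonDeg i'' → i'' ≠ cfg.i → z ∉ cfg.V i'' (cfg.pend i'')) := by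
  intro D cfg x y hx hy
  obtain ⟨x', wx, hx', hwx⟩ := rest_walk_toCompl cfg hx
  obtain ⟨y', wy, hy', hwy⟩ := rest_walk_toCompl cfg hy
  obtain ⟨w, hw⟩ := rest_walk_compl cfg hx' hy'
  refine ⟨wx.append (w.append wy.reverse), fun z hz => ?_⟩
  rw [Walk.mem_support_append_iff, Walk.mem_support_append_iff, Walk.support_reverse, List.mem_reverse] at hz
  rcases hz with hz | hz | hz
  · exact hwx z hz
  · exact Or.inl (hw z hz)
  · exact hwy z hz

end Summit.CriticalPhenomena.SAWScalingLimit.Theorems.FKGToTraversalBound.SlitNecklace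

end
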